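import Summits.SmoothPoincare4.SmoothPoincare4.Theorems.SullivanDualWitnessChargeReductionV9
import Literature.Geometry.Symplectic.JHolomorphicRepresentationFormula

/-!
# Route item `LimitOfEmbeddedPlanes` (stmt-SmoothPoincare4-16809), closed

The support item `Theses.SullivanDual.LimitOfEmbeddedPlanes` (McDuff 1991 §4: compact-uniform
limits of embedded `J`-holomorphic planes that are injective immersions on an annulus separating it
from the disc are injective immersions on the disc) is, definitionally, the Literature named fact
`Literature.Geometry.Symplectic.jHolomorphicLimitOfEmbedded_isEmbedded`. The landed reduction
`helper_limitOfEmbeddedPlanes_of_noCusp` (ReductionV9, crux `WitnessCharge` line `Sketch`) derives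
it from McDuff's no-cusp theorem `jHolomorphic_immersed_of_limitEmbedded_punctured`, which is now
DISCHARGED in Literature (`jHolomorphic_immersed_of_limitEmbedded_punctured_holds`,
`JHolomorphicRepresentationFormula.lean`). Composition, unconditional.
-/

set_option linter.dupNamespace false

namespace Summit.SmoothPoincare4.SmoothPoincare4.Theorems

/-- **Route item `LimitOfEmbeddedPlanes` (stmt-SmoothPoincare4-16809), unconditionally**:
`helper_limitOfEmbeddedPlanes_of_noCusp` at McDuff's discharged no-cusp theorem. -/
theorem limitOfEmbeddedPlanes_proof :
    Summit.SmoothPoincare4.SmoothPoincare4.Theses.SullivanDual.LimitOfEmbeddedPlanes :=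
  WitnessCharge.PencilIncompleteness.helper_limitOfEmbeddedPlanes_of_noCusp
    Literature.Geometry.Symplectic.jHolomorphic_immersed_of_limitEmbedded_punctured_holds

end Summit.SmoothPoincare4.SmoothPoincare4.Theorems
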